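import Summits.Parity.GeneralizedHardyLittlewood.Theorems.BeyondDiagonalBeatsQuarter.OffDiagCoreWinSeparated
import HarnessLib

/-!
# Route `PrimeLevelFamEdge`, crux K_B (stmt-Parity-20343), line `diagonal_kernel_split` rev 4, plan Ω,
# node **L7d part 2, leaf S₃′ — one member's `levelLargePart` over a BLOCK, separated with the block INSIDE the completed
# cut** (L7D-PLAN rev 6 §6; block variant of S₃ `levelLargePart_window_eq_separated`)

In S₃ the completed cut is `coreRange_x ∧ window_x`; its coefficients `convexCoeff` are taken over all of `[1, P−1]`, so a
member whose window misses the block still carries nonzero coefficients there. For the block accounting of the family large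
sieve (L7D-PLAN rev 5 §5 (3): inactive members must vanish IDENTICALLY on the block) the block `β₁ ≤ q ≤ β₂` is put
INSIDE the cut: on a level set `Q ⊆ [β₁, β₂]` the two cuts agree, the conjunction is still convex (`levelConvex_Icc`),
and a member inactive on the block has an EMPTY cut, hence `convexCoeff = 0` for every `k`
(`convexCoeff_eq_zero_of_forall_not`).

* **`levelLargePart_window_block_eq_separated`**, `convexCoeff_eq_zero_of_forall_not`.

Pure algebra of finite sums; standard axioms. Helper toward `stub_offDiagBelowSlack_io`; closes nothing.
«The programme SEARCHES and TYPES; no claim about Landau–Siegel zeros, Theorems 1–2 of arXiv:2211.02515 or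
a repaired Margin232 until a kernel theorem says so.»
-/

noncomputable section

open Finset Real Polynomial

namespace Summit.Parity.GeneralizedHardyLittlewood.Theorems.BeyondDiagonalBeatsQuarter.OffDiag

open Literature.NumberTheory.LFunctions Literature.NumberTheory.LFunctions.KMV2000
open Literature.NumberTheory.Sieve.FriedlanderIwaniecPrimes (fourier2)
open Literature.NumberTheory.Sieve.LargeSieve (e sepCoeff sepWeight)
open PeterssonSplit (nearBoxes)

/-- **An empty cut has zero completion coefficients**: if no `q ∈ [1, P−1]` satisfies `p`, then
`convexCoeff p P k = 0` for every `k`. [folklore] -/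
theorem convexCoeff_eq_zero_of_forall_not {P : ℕ} {p : ℕ → Prop} (hp : ∀ q ∈ Finset.Icc 1 (P - 1), ¬ p q) (k : ℕ) :
    convexCoeff p P k = 0 := by
  classical
  unfold convexCoeff
  rw [dif_neg]
  rintro ⟨q, hq⟩
  rw [Finset.mem_filter] at hq
  exact hp q hq.1 hq.2

open Classical in
/-- **One member's `levelLargePart` over a block, separated, block inside the cut.** As S₃, for a block of levels
`Q ⊆ [β₁, β₂] ∩ [1, P−1]` (prime, `≥ 40`, `> |h₁|`): the completed cut is `(coreRange_x ∧ window_x) ∧ (β₁ ≤ q ≤ β₂)`.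
[cite: KowalskiMichelVanderKam2000, §6 p. 19 — derivation; Vaughan1980, Lemma 2 — derivation] -/
theorem levelLargePart_window_block_eq_separated {P : ℕ} (R : ℕ) (Q : Finset ℕ) (hQ : Q ⊆ Finset.Icc 1 (P - 1))
    {β₁ β₂ : ℕ} (hQb : ∀ q ∈ Q, β₁ ≤ q ∧ q ≤ β₂)
    {Δ' : ℝ} (hΔ : 0 < Δ') {ε₀ : ℝ} (hε₀ : 0 ≤ ε₀) (D : ℕ → ℕ → ℕ → ℕ → ℕ → ℕ × ℕ → ℤ → ℤ → ℂ) (T : ℕ)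
    {r l m : ℕ} (hl : 1 ≤ l) (hm : 1 ≤ m) (d₁ d₂ : ℕ) (i : ℕ × ℕ) {h₁ : ℤ} (s : ℤ)
    (hQp : ∀ q ∈ Q, q.Prime ∧ 40 ≤ q ∧ |h₁| < q) {n : ℕ} (a : ZMod n) :
    levelLargePart R Q (fun q ↦ if (T : ℝ) <
          |(s : ℝ) + ((((l / d₁ : ℕ) : ℤ) * (m / d₂ : ℕ) : ℤ) : ℝ) / ((q * (r + 1) : ℕ) : ℝ)| then 0 else
        coreLevelWeight D (coreHeight ε₀) Δ' r l m d₁ d₂ i h₁ s q) n a =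
      ((if IsUnit ((h₁ : ℤ) : ZMod (r + 1)) ∧ h₁ ≠ 0 then (1 : ℂ) else 0) *
          (if ((switchGcd (r + 1) s h₁ : ℤ) ∣ ((l / d₁ : ℕ) : ℤ) * (m / d₂ : ℕ) ∧
              IsUnit (switchClass (r + 1) (((l / d₁ : ℕ) : ℤ) * (m / d₂ : ℕ)) s h₁)) then (1 : ℂ) else 0) *
          D r l m d₁ d₂ i h₁ s) *
        ∑ k ∈ Finset.range P,
          convexCoeff (fun q ↦ (coreRange Δ' ε₀ r l m d₁ d₂ i h₁ q ∧
              ¬ ((T : ℝ) < |(s : ℝ) + ((((l / d₁ : ℕ) : ℤ) * (m / d₂ : ℕ) : ℤ) : ℝ) / ((q * (r + 1) : ℕ) : ℝ)|)) ∧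
              (β₁ ≤ q ∧ q ≤ β₂)) P k *
            ∑ w ∈ Finset.range 3 ×ˢ Finset.range 3,
              ((trinomCoeff l w.1 * trinomCoeff m w.2 : ℝ) : ℂ) *
                levelLargePart R Q (fun q ↦ e ((k : ℝ) * q / P) * (2 * (qhat q : ℂ) * (2 * π / q)) *
                    (((Real.log (qhat q ^ Δ'))⁻¹ ^ (w.1 + w.2) : ℝ) : ℂ) *
                  fourier2 (boxWeight q d₁ d₂ (l / d₁) (m / d₂) (r + 1) i) (h₁ / (q * (r + 1) : ℕ))
                    ((s : ℝ) / h₁ + (((l / d₁ : ℕ) : ℤ) * (m / d₂ : ℕ) : ℝ) / ((h₁ : ℝ) * (q * (r + 1) : ℕ)))) n a := by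
  -- Step 1: the pointwise factorisation on `Q`
  set E : ℂ := (if IsUnit ((h₁ : ℤ) : ZMod (r + 1)) ∧ h₁ ≠ 0 then (1 : ℂ) else 0) *
      (if ((switchGcd (r + 1) s h₁ : ℤ) ∣ ((l / d₁ : ℕ) : ℤ) * (m / d₂ : ℕ) ∧
          IsUnit (switchClass (r + 1) (((l / d₁ : ℕ) : ℤ) * (m / d₂ : ℕ)) s h₁)) then (1 : ℂ) else 0) *
      D r l m d₁ d₂ i h₁ s with hE
  have hpt : ∀ q ∈ Q, (if (T : ℝ) <
        |(s : ℝ) + ((((l / d₁ : ℕ) : ℤ) * (m / d₂ : ℕ) : ℤ) : ℝ) / ((q * (r + 1) : ℕ) : ℝ)| then 0 else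
      coreLevelWeight D (coreHeight ε₀) Δ' r l m d₁ d₂ i h₁ s q) =
      (if ((coreRange Δ' ε₀ r l m d₁ d₂ i h₁ q ∧
          ¬ ((T : ℝ) < |(s : ℝ) + ((((l / d₁ : ℕ) : ℤ) * (m / d₂ : ℕ) : ℤ) : ℝ) / ((q * (r + 1) : ℕ) : ℝ)|)) ∧
          (β₁ ≤ q ∧ q ≤ β₂))
        then (1 : ℂ) else 0) * (E * ((2 * (qhat q : ℂ) * (2 * π / q)) *
          ((∑ w ∈ Finset.range 3 ×ˢ Finset.range 3,
            trinomCoeff l w.1 * trinomCoeff m w.2 * (Real.log (qhat q ^ Δ'))⁻¹ ^ (w.1 + w.2) : ℝ) : ℂ) *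
          fourier2 (boxWeight q d₁ d₂ (l / d₁) (m / d₂) (r + 1) i) (h₁ / (q * (r + 1) : ℕ))
            ((s : ℝ) / h₁ + (((l / d₁ : ℕ) : ℤ) * (m / d₂ : ℕ) : ℝ) / ((h₁ : ℝ) * (q * (r + 1) : ℕ))))) := by
    intro q hq
    obtain ⟨hqp, hq40, hh⟩ := hQp q hq
    rw [window_coreLevelWeight_eq_factored hqp hq40 hΔ ε₀ D T hl hm d₁ d₂ i hh s, ← hE]
    have hb : β₁ ≤ q ∧ q ≤ β₂ := hQb q hq
    by_cases hp : (coreRange Δ' ε₀ r l m d₁ d₂ i h₁ q ∧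
        ¬ ((T : ℝ) < |(s : ℝ) + ((((l / d₁ : ℕ) : ℤ) * (m / d₂ : ℕ) : ℤ) : ℝ) / ((q * (r + 1) : ℕ) : ℝ)|))
    · rw [if_pos hp, if_pos ⟨hp, hb⟩]; ring
    · rw [if_neg hp, if_neg (fun h ↦ hp h.1)]; ring
  rw [levelLargePart_congr R Q hpt a]
  -- Step 2: completion of the convex cut
  have hconv := levelConvex_and (P := P) (levelConvex_and (P := P)
    (levelConvex_coreRange (P := P) hΔ.le hε₀ r l m d₁ d₂ i h₁)
    (levelConvex_window (P := P) (u := ((((l / d₁ : ℕ) : ℤ) * (m / d₂ : ℕ) : ℤ) : ℝ)) (by positivity)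
      (c := r + 1) (by omega) (s : ℝ) (T : ℝ))) (levelConvex_Icc (P := P) β₁ β₂)
  rw [levelLargePart_ite_one_mul_convex hconv R Q hQ _ a, Finset.mul_sum]
  refine Finset.sum_congr rfl fun k _ ↦ ?_
  -- Step 3: linearity in the level weight: the constant `E` and the trinomial sum come out
  have h3 := levelLargePart_twist_sepSum R Q a (fun q ↦ e ((k : ℝ) * q / P))
    (fun q ↦ 2 * (qhat q : ℂ) * (2 * π / q))
    (fun q ↦ fourier2 (boxWeight q d₁ d₂ (l / d₁) (m / d₂) (r + 1) i) (h₁ / (q * (r + 1) : ℕ))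
      ((s : ℝ) / h₁ + (((l / d₁ : ℕ) : ℤ) * (m / d₂ : ℕ) : ℝ) / ((h₁ : ℝ) * (q * (r + 1) : ℕ))))
    E (Finset.range 3 ×ˢ Finset.range 3) (fun w ↦ trinomCoeff l w.1 * trinomCoeff m w.2)
    (fun q w ↦ (Real.log (qhat q ^ Δ'))⁻¹ ^ (w.1 + w.2))
  beta_reduce at h3
  rw [h3]
  ring

end Summit.Parity.GeneralizedHardyLittlewood.Theorems.BeyondDiagonalBeatsQuarter.OffDiag
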